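import Mathlib
import Literature.Combinatorics.Additive.TripleProductProperty
import Summits.MatrixMultiplication.MatrixMultiplication.Theses.GLnSeparatingDesigns

/-!
# Exact separators read through a ring map give a TPP triple of the same sizes

Stub `stub_tpp_of_exact_separators_map` of line `Ideate5Sketch` (crux `BorderHalfDimensionDesigns`, item
stmt-MatrixMultiplication-18360, route `GLnSeparatingDesigns`): E1's reduction step, the mod-`p` twin of
`tpp_of_separators`.

Let `φ : R →+* F` be a ring map to a field and `X, Y, Z ⊆ GL_n(R)` nonempty finite sets such that every
target `(x₀, z₀) ∈ X × Z` has a polynomial `p` over `R` in the `n²` matrix entries whose value at the sampled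
point `x y⁻¹ y' z⁻¹` is read EXACTLY through `φ`: `φ (p (x y⁻¹ y' z⁻¹)) = 1` if `(x, y, z) = (x₀, y', z₀)` and
`= 0` otherwise.  Write `ψ := GL_n(φ) : GL_n(R) →* GL_n(F)` (`Matrix.GeneralLinearGroup.map φ`).

* Key lemma (`map_quad_eq_map_imp`): `ψ (x y⁻¹ y' z⁻¹) = ψ (x' y⁻¹ y z'⁻¹)` with `x, x' ∈ X`, `y, y' ∈ Y`,
  `z, z' ∈ Z` forces `x = x'`, `y = y'`, `z = z'` in `GL_n(R)`: `φ (p (g)) = eval₂ φ (φ ∘ entries g) p`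
  depends on `g` only through `ψ g` (`MvPolynomial.eval₂_comp`), so the separator of the target `(x', z')`
  takes the same `φ`-value at both points — `1` at the second, `0` at the first unless the triples agree.
* Hence `g ↦ (ψ g)⁻¹` is injective on each of `X, Y, Z` (this is where nonemptiness of the other two sets is
  used), and the inverted images `S = (ψ X)⁻¹, T = (ψ Y)⁻¹, U = (ψ Z)⁻¹` satisfy the tree's right-quotient
  `TripleProductProperty`: `s s'⁻¹ (t t'⁻¹) (u u'⁻¹) = 1` with `s = (ψ x₁)⁻¹, …` unfolds to
  `ψ (x₂ y₁⁻¹ y₂ z₁⁻¹) = ψ (x₁ y₁⁻¹ y₁ z₂⁻¹)`.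

The nonemptiness hypotheses are necessary: with `Y = ∅` (or `X = ∅`, or `Z = ∅`) the separator clause is
vacuous, and e.g. `R = ℤ`, `F = ZMod 2`, `n = 1`, `X = {1, -1}`, `Y = ∅`, `Z = {1}` admits no `S ⊆ GL_1(𝔽_2)`
(one element) with `|S| = 2`.
-/

set_option linter.dupNamespace false

open scoped Matrix

namespace Summit.MatrixMultiplication.MatrixMultiplication.Theorems.BorderHalfDimensionDesigns

/-- **Key lemma.** If the separator of every target is read exactly through `φ`, then two sampled points
`x y⁻¹ y' z⁻¹` and `x' y⁻¹ y z'⁻¹` (`x, x' ∈ X`, `y, y' ∈ Y`, `z, z' ∈ Z`) with the same image under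
`GL_n(φ)` have `x = x'`, `y = y'`, `z = z'`: the `φ`-value of a polynomial over `R` at the entries of `g`
depends only on `GL_n(φ) g`, and the separator of `(x', z')` reads `1` at the second point. [folklore] -/
theorem map_quad_eq_map_imp {R F : Type} [CommRing R] [Field F] {n : ℕ}
    (φ : R →+* F) {X Y Z : Finset (Matrix.GeneralLinearGroup (Fin n) R)}
    (hsep : ∀ x₀ ∈ X, ∀ z₀ ∈ Z, ∃ p : MvPolynomial (Fin n × Fin n) R,
      ∀ x ∈ X, ∀ y ∈ Y, ∀ y' ∈ Y, ∀ z ∈ Z,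
        ((x = x₀ ∧ y = y' ∧ z = z₀) → φ (MvPolynomial.eval (fun ij : Fin n × Fin n =>
          ((x * y⁻¹ * y' * z⁻¹ : Matrix.GeneralLinearGroup (Fin n) R) : Matrix (Fin n) (Fin n) R) ij.1 ij.2) p) = 1) ∧
        (¬ (x = x₀ ∧ y = y' ∧ z = z₀) → φ (MvPolynomial.eval (fun ij : Fin n × Fin n =>
          ((x * y⁻¹ * y' * z⁻¹ : Matrix.GeneralLinearGroup (Fin n) R) : Matrix (Fin n) (Fin n) R) ij.1 ij.2) p) = 0))
    {x x' y y' z z' : Matrix.GeneralLinearGroup (Fin n) R}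
    (hx : x ∈ X) (hx' : x' ∈ X) (hy : y ∈ Y) (hy' : y' ∈ Y) (hz : z ∈ Z) (hz' : z' ∈ Z)
    (h : Matrix.GeneralLinearGroup.map φ (x * y⁻¹ * y' * z⁻¹) =
      Matrix.GeneralLinearGroup.map φ (x' * y⁻¹ * y * z'⁻¹)) :
    x = x' ∧ y = y' ∧ z = z' := by
  obtain ⟨p, hp⟩ := hsep x' hx' z' hz'
  have h1 := (hp x' hx' y hy y hy z' hz').1 ⟨rfl, rfl, rfl⟩
  by_contra hne
  have h0 := (hp x hx y hy y' hy' z hz).2 hne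
  -- the `φ`-value at the entries of `g` depends only on `GL_n(φ) g`
  have hval : ∀ g g' : Matrix.GeneralLinearGroup (Fin n) R,
      Matrix.GeneralLinearGroup.map φ g = Matrix.GeneralLinearGroup.map φ g' →
      φ (MvPolynomial.eval (fun ij : Fin n × Fin n => (g : Matrix (Fin n) (Fin n) R) ij.1 ij.2) p) =
        φ (MvPolynomial.eval (fun ij : Fin n × Fin n => (g' : Matrix (Fin n) (Fin n) R) ij.1 ij.2) p) := by
    intro g g' hgg'
    rw [MvPolynomial.eval₂_comp, MvPolynomial.eval₂_comp]
    congr 1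
    funext ij
    show ((Matrix.GeneralLinearGroup.map φ g : Matrix.GeneralLinearGroup (Fin n) F) :
        Matrix (Fin n) (Fin n) F) ij.1 ij.2 =
      ((Matrix.GeneralLinearGroup.map φ g' : Matrix.GeneralLinearGroup (Fin n) F) :
        Matrix (Fin n) (Fin n) F) ij.1 ij.2
    rw [hgg']
  have := hval _ _ h
  rw [h0, h1] at this
  exact zero_ne_one this

/-- **E1's reduction step** (mod-`p` twin of `tpp_of_separators`): if targets of nonempty
`X, Y, Z ⊆ GL_n(R)` are read EXACTLY (values `1`/`0`) through a ring map `φ : R →+* F` to a field by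
polynomials over `R`, then the (inverted) images in `GL_n(F)` are a triple-product-property triple (tree
convention `TripleProductProperty`, right quotients) of the SAME sizes.  Nonemptiness of all three sets is
needed (otherwise the separator clause is vacuous; see the module docstring for a counterexample). [folklore] -/
theorem stub_tpp_of_exact_separators_map {R F : Type} [CommRing R] [Field F] {n : ℕ}
    (φ : R →+* F) (X Y Z : Finset (Matrix.GeneralLinearGroup (Fin n) R))
    (hX : X.Nonempty) (hY : Y.Nonempty) (hZ : Z.Nonempty)
    (hsep : ∀ x₀ ∈ X, ∀ z₀ ∈ Z, ∃ p : MvPolynomial (Fin n × Fin n) R,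
      ∀ x ∈ X, ∀ y ∈ Y, ∀ y' ∈ Y, ∀ z ∈ Z,
        ((x = x₀ ∧ y = y' ∧ z = z₀) → φ (MvPolynomial.eval (fun ij : Fin n × Fin n =>
          ((x * y⁻¹ * y' * z⁻¹ : Matrix.GeneralLinearGroup (Fin n) R) : Matrix (Fin n) (Fin n) R) ij.1 ij.2) p) = 1) ∧
        (¬ (x = x₀ ∧ y = y' ∧ z = z₀) → φ (MvPolynomial.eval (fun ij : Fin n × Fin n =>
          ((x * y⁻¹ * y' * z⁻¹ : Matrix.GeneralLinearGroup (Fin n) R) : Matrix (Fin n) (Fin n) R) ij.1 ij.2) p) = 0)) :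
    ∃ S T U : Finset (Matrix.GeneralLinearGroup (Fin n) F),
      S.card = X.card ∧ T.card = Y.card ∧ U.card = Z.card ∧
      Literature.Combinatorics.Additive.TripleProductProperty S T U := by
  classical
  obtain ⟨x₀, hx₀⟩ := hX
  obtain ⟨y₀, hy₀⟩ := hY
  obtain ⟨z₀, hz₀⟩ := hZ
  set ψ : Matrix.GeneralLinearGroup (Fin n) R →* Matrix.GeneralLinearGroup (Fin n) F :=
    Matrix.GeneralLinearGroup.map φ with hψ
  have key : ∀ x ∈ X, ∀ x' ∈ X, ∀ y ∈ Y, ∀ y' ∈ Y, ∀ z ∈ Z, ∀ z' ∈ Z,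
      ψ (x * y⁻¹ * y' * z⁻¹) = ψ (x' * y⁻¹ * y * z'⁻¹) → x = x' ∧ y = y' ∧ z = z' :=
    fun x hx x' hx' y hy y' hy' z hz z' hz' h =>
      map_quad_eq_map_imp φ hsep hx hx' hy hy' hz hz' h
  -- the inverted image map is injective on each of the three sets
  have hinjX : Set.InjOn (fun g => (ψ g)⁻¹) (X : Set (Matrix.GeneralLinearGroup (Fin n) R)) := by
    intro x₁ hx₁ x₂ hx₂ h
    have h' : ψ x₁ = ψ x₂ := inv_injective h
    exact (key x₁ hx₁ x₂ hx₂ y₀ hy₀ y₀ hy₀ z₀ hz₀ z₀ hz₀ (by simp only [map_mul, map_inv, h'])).1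
  have hinjY : Set.InjOn (fun g => (ψ g)⁻¹) (Y : Set (Matrix.GeneralLinearGroup (Fin n) R)) := by
    intro y₁ hy₁ y₂ hy₂ h
    have h' : ψ y₁ = ψ y₂ := inv_injective h
    exact (key x₀ hx₀ x₀ hx₀ y₁ hy₁ y₂ hy₂ z₀ hz₀ z₀ hz₀
      (by simp only [map_mul, map_inv, h', inv_mul_cancel_right])).2.1
  have hinjZ : Set.InjOn (fun g => (ψ g)⁻¹) (Z : Set (Matrix.GeneralLinearGroup (Fin n) R)) := by
    intro z₁ hz₁ z₂ hz₂ h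
    have h' : ψ z₁ = ψ z₂ := inv_injective h
    exact (key x₀ hx₀ x₀ hx₀ y₀ hy₀ y₀ hy₀ z₁ hz₁ z₂ hz₂ (by simp only [map_mul, map_inv, h'])).2.2
  refine ⟨X.image fun g => (ψ g)⁻¹, Y.image fun g => (ψ g)⁻¹, Z.image fun g => (ψ g)⁻¹,
    Finset.card_image_of_injOn hinjX, Finset.card_image_of_injOn hinjY,
    Finset.card_image_of_injOn hinjZ, ?_⟩
  intro s hs s' hs' t ht t' ht' u hu u' hu' hrel
  simp only [Finset.mem_image] at hs hs' ht ht' hu hu'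
  obtain ⟨x₁, hx₁, rfl⟩ := hs
  obtain ⟨x₂, hx₂, rfl⟩ := hs'
  obtain ⟨y₁, hy₁, rfl⟩ := ht
  obtain ⟨y₂, hy₂, rfl⟩ := ht'
  obtain ⟨z₁, hz₁, rfl⟩ := hu
  obtain ⟨z₂, hz₂, rfl⟩ := hu'
  have hrel' : (ψ x₁)⁻¹ * ψ x₂ * ((ψ y₁)⁻¹ * ψ y₂) * ((ψ z₁)⁻¹ * ψ z₂) = 1 := by
    simpa only [inv_inv] using hrel
  have hmap : ψ (x₂ * y₁⁻¹ * y₂ * z₁⁻¹) = ψ (x₁ * y₁⁻¹ * y₁ * z₂⁻¹) := by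
    simp only [map_mul, map_inv]
    calc ψ x₂ * (ψ y₁)⁻¹ * ψ y₂ * (ψ z₁)⁻¹
        = ψ x₁ * ((ψ x₁)⁻¹ * ψ x₂ * ((ψ y₁)⁻¹ * ψ y₂) * ((ψ z₁)⁻¹ * ψ z₂)) * (ψ z₂)⁻¹ := by group
      _ = ψ x₁ * (ψ y₁)⁻¹ * ψ y₁ * (ψ z₂)⁻¹ := by rw [hrel']; group
  obtain ⟨h1, h2, h3⟩ := key x₂ hx₂ x₁ hx₁ y₁ hy₁ y₂ hy₂ z₁ hz₁ z₂ hz₂ hmap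
  subst h1 h2 h3
  exact ⟨rfl, rfl, rfl⟩

/-- **Product form, no nonemptiness needed.** Under the same exact-separator hypothesis (and nothing
else) there is a `TripleProductProperty` triple `S, T, U ⊆ GL_n(F)` with
`|S| |T| |U| = |X| |Y| |Z|`: if `X, Y, Z` are all nonempty this is `stub_tpp_of_exact_separators_map`;
otherwise both products vanish with `S = T = U = ∅`.  (The size-by-size version genuinely needs the
three nonemptiness hypotheses; this version is the one a volume bound consumes.) [folklore] -/
theorem tpp_of_exact_separators_map_prod {R F : Type} [CommRing R] [Field F] {n : ℕ}
    (φ : R →+* F) (X Y Z : Finset (Matrix.GeneralLinearGroup (Fin n) R))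
    (hsep : ∀ x₀ ∈ X, ∀ z₀ ∈ Z, ∃ p : MvPolynomial (Fin n × Fin n) R,
      ∀ x ∈ X, ∀ y ∈ Y, ∀ y' ∈ Y, ∀ z ∈ Z,
        ((x = x₀ ∧ y = y' ∧ z = z₀) → φ (MvPolynomial.eval (fun ij : Fin n × Fin n =>
          ((x * y⁻¹ * y' * z⁻¹ : Matrix.GeneralLinearGroup (Fin n) R) : Matrix (Fin n) (Fin n) R) ij.1 ij.2) p) = 1) ∧
        (¬ (x = x₀ ∧ y = y' ∧ z = z₀) → φ (MvPolynomial.eval (fun ij : Fin n × Fin n =>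
          ((x * y⁻¹ * y' * z⁻¹ : Matrix.GeneralLinearGroup (Fin n) R) : Matrix (Fin n) (Fin n) R) ij.1 ij.2) p) = 0)) :
    ∃ S T U : Finset (Matrix.GeneralLinearGroup (Fin n) F),
      S.card * T.card * U.card = X.card * Y.card * Z.card ∧
      Literature.Combinatorics.Additive.TripleProductProperty S T U := by
  by_cases h : X.Nonempty ∧ Y.Nonempty ∧ Z.Nonempty
  · obtain ⟨S, T, U, hS, hT, hU, hTPP⟩ :=
      stub_tpp_of_exact_separators_map φ X Y Z h.1 h.2.1 h.2.2 hsep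
    exact ⟨S, T, U, by rw [hS, hT, hU], hTPP⟩
  · refine ⟨∅, ∅, ∅, ?_, fun s hs => absurd hs (Finset.notMem_empty s)⟩
    simp only [not_and_or, Finset.not_nonempty_iff_eq_empty] at h
    rcases h with h | h | h <;> simp [h]

end Summit.MatrixMultiplication.MatrixMultiplication.Theorems.BorderHalfDimensionDesigns
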